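import Summits.Ventures.YMGap.RobustBall.LocalSourceMassGap
import Summits.Ventures.YMGap.RobustBall.LocalSourceResponseBall
import Summits.Ventures.YMGap.RobustBall.LocalSourceAnalytic
import Summits.Ventures.YMGap.RobustBall.UniformMassGapSUN
import HarnessLib

/-!
# Venture YMGap, track ROBUST-BALL (Y2) — UNIFORMLY ON ds-2's GAUGE-INVARIANT BALL: every member plus ONE MORE LOOP OF ANY STRENGTH
# has a `C¹`/real-analytic response, an exponentially small susceptibility and a mass gap at least `m/2`

HONEST FRAMING. WHAT THIS IS: a venture file (cell `pub-ymgap`, track Y2 ROBUST-BALL, seat rb-p1, theorems only): the local-source package read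
UNIFORMLY on the tier-1 gauge-invariant ball `MemBallZdG ε₀ ε₁ R` (ds-2) of a uniform row `UniformMassGapOnBallZdG d N β ε₀ ε₁ R m A` — the
typed «uniformly on `ClusterDomain`» of the directive, `ℤ^d` side — complementing the Wilson point (`LocalSourceWilson.lean`) and the tier-2
loop ball (`LocalSourceLoopBall.lean`).  For EVERY member `(W, supp)` and ONE closed walk `w₀` with ANY real coupling `t`:
* `ballZdG_singleLoop_hasDerivAt_of_uniform` — every selection `ν t ∈ 𝒢(W + t·Re tr U_{w₀}/N)` and bounded measurable `F`:
  `d/dt ∫F dν_t = −cov_{ν_t}(F, Re tr U_{w₀}/N)` on `ℝ`; `ballZdG_singleLoop_analyticAt_of_uniform` — real-analytic on `ℝ`;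
* `ballZdG_singleLoop_susceptibility_le_of_uniform` — `ν 0 = μ_W` and `|d/dt|_{0}∫F dν_t| ≤ A n² e^{−m d(Λ_F, w₀)} (K_F √N|w₀| + ‖F‖₂‖Re tr U_{w₀}/N‖₂)`;
* `ballZdG_singleLoop_massGap_of_uniform` — every DLR state of `W + t·Re tr U_{w₀}/N` clusters between ANY two Lipschitz cylinders at rate `m/2`,
  constant `A n² e^{2|t|} e^{m|w₀|} (…)` (`A ≥ 1`);
instantiated on the `SU(2)` `ℤ⁴` cell `β_W = 1/8`, quarter radius `(ε₀, ε₁) = (37/500, 37/1000)`, any range `R`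
(`UniformMassGapZdG.su2_uniformStar_oneEighth_quarterRadius`: `m = (1/32)/(max R 1 + 4)`, `A = 64`):
`su2_ballZdG_oneEighth_singleLoop_hasDerivAt / _analyticAt / _susceptibility_le / _massGap`; and for EVERY `N ≥ 2` on the hypothesis-free all-`N`
ball ('t Hooft `|β| ≤ 1/64`, radii `(1/10, 1/20)`, rate `(1/8)/max(1,R)`, constant `16N`; `UniformMassGapSUN.suN_uniformZdRow4_1_64`):
`suN_uniformMassGapOnBallZdG_1_64`, `suN_ballZdG_singleLoop_hasDerivAt / _analyticAt / _massGap`.  (One state for the member plus finitely many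
loops: `LocalSourceLoops.hasUniqueGibbsMeasure_add_loops_of_uniformMassGapOnBallZdG`.)
WHAT THIS IS NOT: rates are comparison lower bounds in units of the door's locality radius; `m/2` is bookkeeping; lattice strong coupling;
nothing about the continuum limit or a Clay-sense mass gap.
-/

noncomputable section

open MeasureTheory Function Finset Real ProbabilityTheory
open scoped NNReal
open Literature.Probability.LatticeModels
open Literature.MathematicalPhysics.QuantumLattice
open Literature.MathematicalPhysics.QuantumFieldTheory hiding ZdEdge Site

namespace Summit.Ventures.YMGap.RobustBall

variable {d N : ℕ}

/-! ### Generic: a member of the gauge ball plus one loop of any strength -/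

section Generic

variable {β ε₀ ε₁ m A : ℝ} {R : ℕ} {W : Potential (ZdEdge d) (SUN N)} {supp : Finset (ZdEdge d) → Finset (Finset (ZdEdge d))}

/-- The tier-1 data of the one-loop source with coupling `t`. -/
private theorem singleLoopG_data {x : Literature.Probability.LatticeModels.Site d} (w₀ : (zdGraph d).Walk x x) (t : ℝ) :
    (loopFamilyAction (d := d) N (fun _ : Unit => (⟨x, w₀⟩ : ZdLoop d)) fun _ => t).IsAdapted ∧
    (∀ X, ∃ C, ∀ U, |loopFamilyAction (d := d) N (fun _ : Unit => (⟨x, w₀⟩ : ZdLoop d)) (fun _ => t) X U| ≤ C) ∧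
    (loopFamilyAction (d := d) N (fun _ : Unit => (⟨x, w₀⟩ : ZdLoop d)) fun _ => t).IsSupportedBy
      (loopSupp (fun _ : Unit => (⟨x, w₀⟩ : ZdLoop d))) ∧
    (∀ Λ, loopSupp (fun _ : Unit => (⟨x, w₀⟩ : ZdLoop d)) Λ ⊆
      (Finset.univ : Finset Unit).image fun i => walkEdges ((fun _ : Unit => (⟨x, w₀⟩ : ZdLoop d)) i).walk) := by
  classical
  have hV := memBallZd_loopFamilyAction_fintype (N := N) (fun _ : Unit => (⟨x, w₀⟩ : ZdLoop d)) fun _ => t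
  exact ⟨fun X => ⟨hV.dependsOn X, (hV.continuous X).measurable⟩, fun X => exists_bound_of_continuous (hV.continuous X),
    hV.supportedBy, fun Λ => Finset.image_subset_image (Finset.subset_univ _)⟩

/-- The catalogue of the one-loop source is `{links of w₀}`. -/
private theorem singleLoopG_image {x : Literature.Probability.LatticeModels.Site d} (w₀ : (zdGraph d).Walk x x) :
    (Finset.univ : Finset Unit).image (fun i => walkEdges ((fun _ : Unit => (⟨x, w₀⟩ : ZdLoop d)) i).walk) = {walkEdges w₀} := by
  classical
  ext X
  simp only [Finset.mem_image, Finset.mem_univ, true_and, Finset.mem_singleton]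
  exact ⟨fun ⟨_, h⟩ => h.symm, fun h => ⟨(), h.symm⟩⟩

/-- The family `t ↦ member + loop with coupling t` is `W + t • V₁`. -/
private theorem ballZdG_family (x : Literature.Probability.LatticeModels.Site d) (w₀ : (zdGraph d).Walk x x) (t : ℝ) :
    W + loopFamilyAction (d := d) N (fun _ : Unit => (⟨x, w₀⟩ : ZdLoop d)) (fun _ => t) =
      W + t • loopFamilyAction (d := d) N (fun _ : Unit => (⟨x, w₀⟩ : ZdLoop d)) fun _ => (1 : ℝ) := by
  rw [← loopFamilyAction_smul]
  simp only [mul_one]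

/-- **FEYNMAN–HELLMANN UNIFORMLY ON THE GAUGE BALL.** For `UniformMassGapOnBallZdG d N β ε₀ ε₁ R m A`, every member `(W, supp)`, one closed walk
`w₀`, every selection `ν t` of DLR states of `W + t · Re tr U_{w₀}/N`, and every bounded measurable `F`:
`d/dt ∫ F dν_t |_{t=b} = −cov_{ν_b}(F, Re tr U_{w₀}/N)` at every real `b`. -/
theorem ballZdG_singleLoop_hasDerivAt_of_uniform (hball : UniformMassGapOnBallZdG d N β ε₀ ε₁ R m A) (hW : MemBallZdG ε₀ ε₁ R W supp)
    {x : Literature.Probability.LatticeModels.Site d} (w₀ : (zdGraph d).Walk x x)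
    {ν : ℝ → Measure (LGConfig d (SUN N))}
    (hν : ∀ t, ν t ∈ perturbedGibbsMeasures (d := d) (fundamentalRep (Fin N)) (N * β)
      (W + loopFamilyAction (d := d) N (fun _ : Unit => (⟨x, w₀⟩ : ZdLoop d)) (fun _ => t))
      (fun Λ => supp Λ ∪ loopSupp (fun _ : Unit => (⟨x, w₀⟩ : ZdLoop d)) Λ))
    {F : LGConfig d (SUN N) → ℝ} (hFm : Measurable F) {C : ℝ} (hFb : ∀ U, |F U| ≤ C) (b : ℝ) :
    HasDerivAt (fun t => ∫ U, F U ∂(ν t)) (-cov[F, loopTerm (d := d) N 1 w₀; ν b]) b := by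
  classical
  obtain ⟨hVa, hVb, hVs, hT⟩ := singleLoopG_data (N := N) w₀ (1 : ℝ)
  have hν' : ∀ t, ν t ∈ perturbedGibbsMeasures (d := d) (fundamentalRep (Fin N)) (N * β)
      (W + t • loopFamilyAction (d := d) N (fun _ : Unit => (⟨x, w₀⟩ : ZdLoop d)) fun _ => (1 : ℝ))
      (fun Λ => supp Λ ∪ loopSupp (fun _ : Unit => (⟨x, w₀⟩ : ZdLoop d)) Λ) := by
    intro t
    rw [← ballZdG_family x w₀ t]
    exact hν t
  have key := hasDerivAt_integral_of_uniformMassGapOnBallZdG hball hW hVa hVb hVs hT hν' hFm hFb b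
  have hH : (fun U : LGConfig d (SUN N) => ∑ A ∈ (Finset.univ : Finset Unit).image
      (fun i => walkEdges ((fun _ : Unit => (⟨x, w₀⟩ : ZdLoop d)) i).walk),
      loopFamilyAction (d := d) N (fun _ : Unit => (⟨x, w₀⟩ : ZdLoop d)) (fun _ => (1 : ℝ)) A U) = loopTerm (d := d) N 1 w₀ :=
    funext fun U => sum_singleLoop_source w₀ U
  rw [hH] at key
  exact key

/-- **REAL-ANALYTICITY UNIFORMLY ON THE GAUGE BALL**: `t ↦ ∫ F dν_t` is real-analytic at every `t₀ ∈ ℝ`. -/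
theorem ballZdG_singleLoop_analyticAt_of_uniform (hball : UniformMassGapOnBallZdG d N β ε₀ ε₁ R m A) (hW : MemBallZdG ε₀ ε₁ R W supp)
    {x : Literature.Probability.LatticeModels.Site d} (w₀ : (zdGraph d).Walk x x)
    {ν : ℝ → Measure (LGConfig d (SUN N))}
    (hν : ∀ t, ν t ∈ perturbedGibbsMeasures (d := d) (fundamentalRep (Fin N)) (N * β)
      (W + loopFamilyAction (d := d) N (fun _ : Unit => (⟨x, w₀⟩ : ZdLoop d)) (fun _ => t))
      (fun Λ => supp Λ ∪ loopSupp (fun _ : Unit => (⟨x, w₀⟩ : ZdLoop d)) Λ))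
    {F : LGConfig d (SUN N) → ℝ} (hFm : Measurable F) {C : ℝ} (hFb : ∀ U, |F U| ≤ C) (t₀ : ℝ) :
    AnalyticAt ℝ (fun t => ∫ U, F U ∂(ν t)) t₀ := by
  classical
  obtain ⟨hVa, hVb, hVs, hT⟩ := singleLoopG_data (N := N) w₀ (1 : ℝ)
  have hν' : ∀ t, ν t ∈ perturbedGibbsMeasures (d := d) (fundamentalRep (Fin N)) (N * β)
      (W + t • loopFamilyAction (d := d) N (fun _ : Unit => (⟨x, w₀⟩ : ZdLoop d)) fun _ => (1 : ℝ))
      (fun Λ => supp Λ ∪ loopSupp (fun _ : Unit => (⟨x, w₀⟩ : ZdLoop d)) Λ) := by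
    intro t
    rw [← ballZdG_family x w₀ t]
    exact hν t
  exact analyticAt_integral_of_uniformMassGapOnBallZdG hball hW hVa hVb hVs hT hν' hFm hFb t₀

/-- **THE SUSCEPTIBILITY TO ONE MORE LOOP IS EXPONENTIALLY SMALL IN THE SEPARATION, UNIFORMLY ON THE GAUGE BALL**: for the member's DLR state
`μ`, every selection `ν t` and every Lipschitz cylinder `F` on `Λ_F` disjoint from the links of `w₀` (`|Λ_F|, |links w₀| ≤ n`):
`|d/dt|_{t=0} ∫ F dν_t| ≤ A n² e^{−m d(Λ_F, w₀)} (K_F · √N |w₀| + ‖F‖₂ ‖Re tr U_{w₀}/N‖₂)`. -/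
theorem ballZdG_singleLoop_susceptibility_le_of_uniform (hball : UniformMassGapOnBallZdG d N β ε₀ ε₁ R m A)
    (hW : MemBallZdG ε₀ ε₁ R W supp)
    {μ : Measure (LGConfig d (SUN N))} (hμ : μ ∈ perturbedGibbsMeasures (d := d) (fundamentalRep (Fin N)) (N * β) W supp)
    {x : Literature.Probability.LatticeModels.Site d} (w₀ : (zdGraph d).Walk x x)
    {ν : ℝ → Measure (LGConfig d (SUN N))}
    (hν : ∀ t, ν t ∈ perturbedGibbsMeasures (d := d) (fundamentalRep (Fin N)) (N * β)
      (W + loopFamilyAction (d := d) N (fun _ : Unit => (⟨x, w₀⟩ : ZdLoop d)) (fun _ => t))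
      (fun Λ => supp Λ ∪ loopSupp (fun _ : Unit => (⟨x, w₀⟩ : ZdLoop d)) Λ))
    {n : ℕ} {F : LGConfig d (SUN N) → ℝ} {ΛF : Finset (ZdEdge d)} {KF : ℝ≥0}
    (hF : IsLipschitzCylinder (fundamentalRep (Fin N)) F ΛF KF) (hΛF : ΛF.card ≤ n) (hwn : (walkEdges w₀).card ≤ n)
    (hdisj : Disjoint ΛF (walkEdges w₀)) :
    ∃ χ : ℝ, HasDerivAt (fun t => ∫ U, F U ∂(ν t)) χ 0 ∧
      |χ| ≤ A * (n : ℝ) ^ 2 * Real.exp (-m * setDistEdges ΛF (walkEdges w₀)) *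
        ((KF : ℝ) * (|(1 : ℝ)| * Real.sqrt N * w₀.length) +
          Real.sqrt (∫ U, F U ^ 2 ∂μ) * Real.sqrt (∫ U, loopTerm (d := d) N 1 w₀ U ^ 2 ∂μ)) := by
  classical
  obtain ⟨hVa, hVb, hVs, hT⟩ := singleLoopG_data (N := N) w₀ (1 : ℝ)
  have himg := singleLoopG_image (d := d) w₀
  have hν' : ∀ t, ν t ∈ perturbedGibbsMeasures (d := d) (fundamentalRep (Fin N)) (N * β)
      (W + t • loopFamilyAction (d := d) N (fun _ : Unit => (⟨x, w₀⟩ : ZdLoop d)) fun _ => (1 : ℝ))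
      (fun Λ => supp Λ ∪ loopSupp (fun _ : Unit => (⟨x, w₀⟩ : ZdLoop d)) Λ) := by
    intro t
    rw [← ballZdG_family x w₀ t]
    exact hν t
  set Kc : Finset (ZdEdge d) → ℝ≥0 := fun _ => ⟨|(1 : ℝ)| * Real.sqrt N * w₀.length, by positivity⟩ with hKc
  have hKcc : ∀ X, (Kc X : ℝ) = |(1 : ℝ)| * Real.sqrt N * w₀.length := fun X => by rw [hKc]; rfl
  have hVL : ∀ X ∈ (Finset.univ : Finset Unit).image (fun i => walkEdges ((fun _ : Unit => (⟨x, w₀⟩ : ZdLoop d)) i).walk),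
      IsLipschitzCylinder (fundamentalRep (Fin N)) (loopFamilyAction (d := d) N (fun _ : Unit => (⟨x, w₀⟩ : ZdLoop d)) (fun _ => (1 : ℝ)) X)
        X (Kc X) := by
    intro X hX
    rw [himg, Finset.mem_singleton] at hX
    subst hX
    rw [loopFamilyAction_single_apply]
    exact isLipschitzCylinder_loopTerm (N := N) 1 w₀
  have key := abs_susceptibility_le_of_uniformMassGapOnBallZdG hball hW hμ hVa hVb hVs hT hν' (n := n) hF hΛF (K := Kc) hVL
    (fun X hX => by rw [himg, Finset.mem_singleton] at hX; subst hX; exact hwn)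
    (fun X hX => by rw [himg, Finset.mem_singleton] at hX; subst hX; exact hdisj)
  obtain ⟨χ, hχ, hle⟩ := key
  refine ⟨χ, hχ, hle.trans (le_of_eq ?_)⟩
  rw [himg, Finset.sum_singleton, loopFamilyAction_single_apply, hKcc (walkEdges w₀)]
  ring

/-- ★ **THE MASS GAP SURVIVES ONE MORE LOOP OF ANY STRENGTH, UNIFORMLY ON THE GAUGE BALL** (`A ≥ 1`): for every member `(W, supp)` and every DLR
state `ν` of `W + t · Re tr U_{w₀}/N`, all Lipschitz cylinders `F`, `G` on disjoint link sets with `|Λ_F ∪ links w₀|, |Λ_G ∪ links w₀| ≤ n`: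
`|cov_ν(F, G)| ≤ A n² e^{2|t|} e^{m|w₀|} e^{−(m/2) d(Λ_F, Λ_G)} (K_F K_G + 2 (|t|√N|w₀|)(M_F K_G + M_G K_F) + 2 M_F M_G)`. -/
theorem ballZdG_singleLoop_massGap_of_uniform (hball : UniformMassGapOnBallZdG d N β ε₀ ε₁ R m A) (hA : 1 ≤ A)
    (hW : MemBallZdG ε₀ ε₁ R W supp)
    {x : Literature.Probability.LatticeModels.Site d} (w₀ : (zdGraph d).Walk x x) (t : ℝ)
    {ν : Measure (LGConfig d (SUN N))}
    (hν : ν ∈ perturbedGibbsMeasures (d := d) (fundamentalRep (Fin N)) (N * β)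
      (W + loopFamilyAction (d := d) N (fun _ : Unit => (⟨x, w₀⟩ : ZdLoop d)) (fun _ => t))
      (fun Λ => supp Λ ∪ loopSupp (fun _ : Unit => (⟨x, w₀⟩ : ZdLoop d)) Λ))
    {n : ℕ} {F G : LGConfig d (SUN N) → ℝ} {ΛF ΛG : Finset (ZdEdge d)} {KF KG MF MG : ℝ≥0}
    (hF : IsLipschitzCylinder (fundamentalRep (Fin N)) F ΛF KF) (hMF : ∀ U, |F U| ≤ MF)
    (hG : IsLipschitzCylinder (fundamentalRep (Fin N)) G ΛG KG) (hMG : ∀ U, |G U| ≤ MG)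
    (hn₁ : (ΛF ∪ walkEdges w₀).card ≤ n) (hn₂ : (ΛG ∪ walkEdges w₀).card ≤ n) (hdisj : Disjoint ΛF ΛG) :
    |cov[F, G; ν]| ≤ A * (n : ℝ) ^ 2 * exp (2 * |t|) * exp (m * (2 * w₀.length) / 2) *
        exp (-(m / 2) * setDistEdges ΛF ΛG) *
      ((KF : ℝ) * KG + 2 * (|t| * Real.sqrt N * w₀.length) * (MF * KG + MG * KF) + 2 * MF * MG) := by
  classical
  obtain ⟨hVa, hVb, hVs, hT⟩ := singleLoopG_data (N := N) w₀ t
  have himg := singleLoopG_image (d := d) w₀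
  set Kc : Finset (ZdEdge d) → ℝ≥0 := fun _ => ⟨|t| * Real.sqrt N * w₀.length, by positivity⟩ with hKc
  have hKcc : ∀ X, (Kc X : ℝ) = |t| * Real.sqrt N * w₀.length := fun X => by rw [hKc]; rfl
  have hVL : ∀ X ∈ (Finset.univ : Finset Unit).image (fun i => walkEdges ((fun _ : Unit => (⟨x, w₀⟩ : ZdLoop d)) i).walk),
      IsLipschitzCylinder (fundamentalRep (Fin N)) (loopFamilyAction (d := d) N (fun _ : Unit => (⟨x, w₀⟩ : ZdLoop d)) (fun _ => t) X)
        X (Kc X) := by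
    intro X hX
    rw [himg, Finset.mem_singleton] at hX
    subst hX
    rw [loopFamilyAction_single_apply]
    exact isLipschitzCylinder_loopTerm (N := N) t w₀
  have hS : ∀ X ∈ (Finset.univ : Finset Unit).image (fun i => walkEdges ((fun _ : Unit => (⟨x, w₀⟩ : ZdLoop d)) i).walk),
      X ⊆ walkEdges w₀ := by
    intro X hX
    rw [himg, Finset.mem_singleton] at hX
    exact hX.le
  have hB : ∀ U, |∑ X ∈ (Finset.univ : Finset Unit).image (fun i => walkEdges ((fun _ : Unit => (⟨x, w₀⟩ : ZdLoop d)) i).walk),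
      loopFamilyAction (d := d) N (fun _ : Unit => (⟨x, w₀⟩ : ZdLoop d)) (fun _ => t) X U| ≤ |t| := by
    intro U
    rw [himg, Finset.sum_singleton, loopFamilyAction_single_apply]
    exact abs_loopTerm_le w₀ U
  have hδ : ∀ s ∈ walkEdges w₀, ∀ s' ∈ walkEdges w₀, ‖s.1 - s'.1‖ ≤ 2 * (w₀.length : ℝ) := fun s hs s' hs' =>
    norm_sub_le_two_mul_length_of_mem_walkEdges w₀ hs hs'
  have key := abs_cov_le_halfRate_of_uniformMassGapOnBallZdG_add hball hA hW hVa hVb hVs hT hVL hS hB (by positivity) hδ hν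
    hF hMF hG hMG hn₁ hn₂ hdisj
  have hsum : ((∑ X ∈ (Finset.univ : Finset Unit).image (fun i => walkEdges ((fun _ : Unit => (⟨x, w₀⟩ : ZdLoop d)) i).walk),
      Kc X : ℝ≥0) : ℝ) = |t| * Real.sqrt N * w₀.length := by
    rw [himg, Finset.sum_singleton]; exact hKcc (walkEdges w₀)
  rw [hsum] at key
  exact key

end Generic

/-! ### `SU(2)`, `d = 4`, `β_W = 1/8`, quarter radius `(37/500, 37/1000)`, any range `R`: rate `(1/32)/(max R 1 + 4)`, constant `64` -/

section SU2

variable {R : ℕ} {W : Potential (ZdEdge 4) (SUN 2)} {supp : Finset (ZdEdge 4) → Finset (Finset (ZdEdge 4))}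

/-- **`SU(2)`, `β_W = 1/8`, quarter-radius gauge ball, Feynman–Hellmann for one more loop of any strength.** -/
theorem su2_ballZdG_oneEighth_singleLoop_hasDerivAt (hW : MemBallZdG (37 / 500) (37 / 1000) R W supp)
    {x : Literature.Probability.LatticeModels.Site 4} (w₀ : (zdGraph 4).Walk x x)
    {ν : ℝ → Measure (LGConfig 4 (SUN 2))}
    (hν : ∀ t, ν t ∈ perturbedGibbsMeasures (d := 4) (fundamentalRep (Fin 2)) (2 * (1 / 32 : ℝ))
      (W + loopFamilyAction (d := 4) 2 (fun _ : Unit => (⟨x, w₀⟩ : ZdLoop 4)) (fun _ => t))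
      (fun Λ => supp Λ ∪ loopSupp (fun _ : Unit => (⟨x, w₀⟩ : ZdLoop 4)) Λ))
    {F : LGConfig 4 (SUN 2) → ℝ} (hFm : Measurable F) {C : ℝ} (hFb : ∀ U, |F U| ≤ C) (b : ℝ) :
    HasDerivAt (fun t => ∫ U, F U ∂(ν t)) (-cov[F, loopTerm (d := 4) 2 1 w₀; ν b]) b :=
  ballZdG_singleLoop_hasDerivAt_of_uniform (su2_uniformStar_oneEighth_quarterRadius R) hW w₀ hν hFm hFb b

/-- **`SU(2)`, `β_W = 1/8`, quarter-radius gauge ball, real-analytic response to one more loop.** -/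
theorem su2_ballZdG_oneEighth_singleLoop_analyticAt (hW : MemBallZdG (37 / 500) (37 / 1000) R W supp)
    {x : Literature.Probability.LatticeModels.Site 4} (w₀ : (zdGraph 4).Walk x x)
    {ν : ℝ → Measure (LGConfig 4 (SUN 2))}
    (hν : ∀ t, ν t ∈ perturbedGibbsMeasures (d := 4) (fundamentalRep (Fin 2)) (2 * (1 / 32 : ℝ))
      (W + loopFamilyAction (d := 4) 2 (fun _ : Unit => (⟨x, w₀⟩ : ZdLoop 4)) (fun _ => t))
      (fun Λ => supp Λ ∪ loopSupp (fun _ : Unit => (⟨x, w₀⟩ : ZdLoop 4)) Λ))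
    {F : LGConfig 4 (SUN 2) → ℝ} (hFm : Measurable F) {C : ℝ} (hFb : ∀ U, |F U| ≤ C) (t₀ : ℝ) :
    AnalyticAt ℝ (fun t => ∫ U, F U ∂(ν t)) t₀ :=
  ballZdG_singleLoop_analyticAt_of_uniform (su2_uniformStar_oneEighth_quarterRadius R) hW w₀ hν hFm hFb t₀

/-- **`SU(2)`, `β_W = 1/8`, quarter-radius gauge ball: the susceptibility to one more loop is `≤ 64 n² e^{−((1/32)/(max R 1+4)) d(Λ_F, w₀)} (…)`.** -/
theorem su2_ballZdG_oneEighth_singleLoop_susceptibility_le (hW : MemBallZdG (37 / 500) (37 / 1000) R W supp)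
    {μ : Measure (LGConfig 4 (SUN 2))} (hμ : μ ∈ perturbedGibbsMeasures (d := 4) (fundamentalRep (Fin 2)) (2 * (1 / 32 : ℝ)) W supp)
    {x : Literature.Probability.LatticeModels.Site 4} (w₀ : (zdGraph 4).Walk x x)
    {ν : ℝ → Measure (LGConfig 4 (SUN 2))}
    (hν : ∀ t, ν t ∈ perturbedGibbsMeasures (d := 4) (fundamentalRep (Fin 2)) (2 * (1 / 32 : ℝ))
      (W + loopFamilyAction (d := 4) 2 (fun _ : Unit => (⟨x, w₀⟩ : ZdLoop 4)) (fun _ => t))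
      (fun Λ => supp Λ ∪ loopSupp (fun _ : Unit => (⟨x, w₀⟩ : ZdLoop 4)) Λ))
    {n : ℕ} {F : LGConfig 4 (SUN 2) → ℝ} {ΛF : Finset (ZdEdge 4)} {KF : ℝ≥0}
    (hF : IsLipschitzCylinder (fundamentalRep (Fin 2)) F ΛF KF) (hΛF : ΛF.card ≤ n) (hwn : (walkEdges w₀).card ≤ n)
    (hdisj : Disjoint ΛF (walkEdges w₀)) :
    ∃ χ : ℝ, HasDerivAt (fun t => ∫ U, F U ∂(ν t)) χ 0 ∧
      |χ| ≤ 64 * (n : ℝ) ^ 2 * Real.exp (-((1 / 32 : ℝ) / (max R 1 + 4 : ℕ)) * setDistEdges ΛF (walkEdges w₀)) *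
        ((KF : ℝ) * (|(1 : ℝ)| * Real.sqrt (2 : ℕ) * w₀.length) +
          Real.sqrt (∫ U, F U ^ 2 ∂μ) * Real.sqrt (∫ U, loopTerm (d := 4) 2 1 w₀ U ^ 2 ∂μ)) :=
  ballZdG_singleLoop_susceptibility_le_of_uniform (su2_uniformStar_oneEighth_quarterRadius R) hW hμ w₀ hν hF hΛF hwn hdisj

/-- ★ **`SU(2)`, `β_W = 1/8`, QUARTER-RADIUS GAUGE BALL: ONE MORE LOOP OF ANY STRENGTH DOES NOT CLOSE THE MASS GAP** — every DLR state of every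
member plus `t · Re tr U_{w₀}/2` clusters between ANY two Lipschitz cylinders at rate `(1/64)/(max R 1 + 4)`, constant
`64 n² e^{2|t|} e^{((1/32)/(max R 1+4))|w₀|} (…)`. -/
theorem su2_ballZdG_oneEighth_singleLoop_massGap (hW : MemBallZdG (37 / 500) (37 / 1000) R W supp)
    {x : Literature.Probability.LatticeModels.Site 4} (w₀ : (zdGraph 4).Walk x x) (t : ℝ)
    {ν : Measure (LGConfig 4 (SUN 2))}
    (hν : ν ∈ perturbedGibbsMeasures (d := 4) (fundamentalRep (Fin 2)) (2 * (1 / 32 : ℝ))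
      (W + loopFamilyAction (d := 4) 2 (fun _ : Unit => (⟨x, w₀⟩ : ZdLoop 4)) (fun _ => t))
      (fun Λ => supp Λ ∪ loopSupp (fun _ : Unit => (⟨x, w₀⟩ : ZdLoop 4)) Λ))
    {n : ℕ} {F G : LGConfig 4 (SUN 2) → ℝ} {ΛF ΛG : Finset (ZdEdge 4)} {KF KG MF MG : ℝ≥0}
    (hF : IsLipschitzCylinder (fundamentalRep (Fin 2)) F ΛF KF) (hMF : ∀ U, |F U| ≤ MF)
    (hG : IsLipschitzCylinder (fundamentalRep (Fin 2)) G ΛG KG) (hMG : ∀ U, |G U| ≤ MG)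
    (hn₁ : (ΛF ∪ walkEdges w₀).card ≤ n) (hn₂ : (ΛG ∪ walkEdges w₀).card ≤ n) (hdisj : Disjoint ΛF ΛG) :
    |cov[F, G; ν]| ≤ 64 * (n : ℝ) ^ 2 * exp (2 * |t|) * exp (((1 / 32 : ℝ) / (max R 1 + 4 : ℕ)) * (2 * w₀.length) / 2) *
        exp (-(((1 / 32 : ℝ) / (max R 1 + 4 : ℕ)) / 2) * setDistEdges ΛF ΛG) *
      ((KF : ℝ) * KG + 2 * (|t| * Real.sqrt (2 : ℕ) * w₀.length) * (MF * KG + MG * KF) + 2 * MF * MG) :=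
  ballZdG_singleLoop_massGap_of_uniform (su2_uniformStar_oneEighth_quarterRadius R) (by norm_num) hW w₀ t hν hF hMF hG hMG hn₁ hn₂ hdisj

end SU2

/-! ### Every `N ≥ 2`, `d = 4`, 't Hooft `|β| ≤ 1/64`, radii `(1/10, 1/20)`, any range `R`: rate `(1/8)/max(1,R)`, constant `16N`
(hypothesis-free Bakry–Émery tier-1 row `suN_uniformZdRow4_1_64`, read on the gauge ball) -/

section SUN

variable {β : ℝ} {R : ℕ} {W : Potential (ZdEdge 4) (SUN N)} {supp : Finset (ZdEdge 4) → Finset (Finset (ZdEdge 4))}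

/-- **The all-`N` tier-1 row as a uniform gauge-ball row**: `UniformMassGapOnBallZdG 4 N β (1/10) (1/20) R ((1/8)/max(1,R)) (16N)` for
`|β| ≤ 1/64` ('t Hooft). -/
theorem suN_uniformMassGapOnBallZdG_1_64 (hN : 2 ≤ N) (hβ : |β| ≤ 1 / 64) (R : ℕ) :
    UniformMassGapOnBallZdG 4 N β (2 * (1 / 20)) (1 / 20) R ((1 - 7 / 8) / max 1 (R : ℝ)) (16 * N) :=
  (suN_uniformZdRow4_1_64 hN hβ (R : ℝ)).uniformMassGapOnBallZdG

/-- **Every `N ≥ 2`: Feynman–Hellmann for a member of the all-`N` gauge ball plus one more loop of any strength.** -/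
theorem suN_ballZdG_singleLoop_hasDerivAt (hN : 2 ≤ N) (hβ : |β| ≤ 1 / 64) (hW : MemBallZdG (2 * (1 / 20)) (1 / 20) R W supp)
    {x : Literature.Probability.LatticeModels.Site 4} (w₀ : (zdGraph 4).Walk x x)
    {ν : ℝ → Measure (LGConfig 4 (SUN N))}
    (hν : ∀ t, ν t ∈ perturbedGibbsMeasures (d := 4) (fundamentalRep (Fin N)) (N * β)
      (W + loopFamilyAction (d := 4) N (fun _ : Unit => (⟨x, w₀⟩ : ZdLoop 4)) (fun _ => t))
      (fun Λ => supp Λ ∪ loopSupp (fun _ : Unit => (⟨x, w₀⟩ : ZdLoop 4)) Λ))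
    {F : LGConfig 4 (SUN N) → ℝ} (hFm : Measurable F) {C : ℝ} (hFb : ∀ U, |F U| ≤ C) (b : ℝ) :
    HasDerivAt (fun t => ∫ U, F U ∂(ν t)) (-cov[F, loopTerm (d := 4) N 1 w₀; ν b]) b :=
  ballZdG_singleLoop_hasDerivAt_of_uniform (suN_uniformMassGapOnBallZdG_1_64 hN hβ R) hW w₀ hν hFm hFb b

/-- **Every `N ≥ 2`: real-analytic response on the all-`N` gauge ball.** -/
theorem suN_ballZdG_singleLoop_analyticAt (hN : 2 ≤ N) (hβ : |β| ≤ 1 / 64) (hW : MemBallZdG (2 * (1 / 20)) (1 / 20) R W supp)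
    {x : Literature.Probability.LatticeModels.Site 4} (w₀ : (zdGraph 4).Walk x x)
    {ν : ℝ → Measure (LGConfig 4 (SUN N))}
    (hν : ∀ t, ν t ∈ perturbedGibbsMeasures (d := 4) (fundamentalRep (Fin N)) (N * β)
      (W + loopFamilyAction (d := 4) N (fun _ : Unit => (⟨x, w₀⟩ : ZdLoop 4)) (fun _ => t))
      (fun Λ => supp Λ ∪ loopSupp (fun _ : Unit => (⟨x, w₀⟩ : ZdLoop 4)) Λ))
    {F : LGConfig 4 (SUN N) → ℝ} (hFm : Measurable F) {C : ℝ} (hFb : ∀ U, |F U| ≤ C) (t₀ : ℝ) :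
    AnalyticAt ℝ (fun t => ∫ U, F U ∂(ν t)) t₀ :=
  ballZdG_singleLoop_analyticAt_of_uniform (suN_uniformMassGapOnBallZdG_1_64 hN hβ R) hW w₀ hν hFm hFb t₀

/-- ★ **Every `N ≥ 2`: ONE MORE LOOP OF ANY STRENGTH DOES NOT CLOSE THE MASS GAP, UNIFORMLY ON THE ALL-`N` GAUGE BALL** (radii `(1/10, 1/20)`,
't Hooft `|β| ≤ 1/64`): rate `((1/8)/max(1,R))/2`, constant `16N n² e^{2|t|} e^{((1/8)/max(1,R))|w₀|} (…)`. -/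
theorem suN_ballZdG_singleLoop_massGap (hN : 2 ≤ N) (hβ : |β| ≤ 1 / 64) (hW : MemBallZdG (2 * (1 / 20)) (1 / 20) R W supp)
    {x : Literature.Probability.LatticeModels.Site 4} (w₀ : (zdGraph 4).Walk x x) (t : ℝ)
    {ν : Measure (LGConfig 4 (SUN N))}
    (hν : ν ∈ perturbedGibbsMeasures (d := 4) (fundamentalRep (Fin N)) (N * β)
      (W + loopFamilyAction (d := 4) N (fun _ : Unit => (⟨x, w₀⟩ : ZdLoop 4)) (fun _ => t))
      (fun Λ => supp Λ ∪ loopSupp (fun _ : Unit => (⟨x, w₀⟩ : ZdLoop 4)) Λ))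
    {n : ℕ} {F G : LGConfig 4 (SUN N) → ℝ} {ΛF ΛG : Finset (ZdEdge 4)} {KF KG MF MG : ℝ≥0}
    (hF : IsLipschitzCylinder (fundamentalRep (Fin N)) F ΛF KF) (hMF : ∀ U, |F U| ≤ MF)
    (hG : IsLipschitzCylinder (fundamentalRep (Fin N)) G ΛG KG) (hMG : ∀ U, |G U| ≤ MG)
    (hn₁ : (ΛF ∪ walkEdges w₀).card ≤ n) (hn₂ : (ΛG ∪ walkEdges w₀).card ≤ n) (hdisj : Disjoint ΛF ΛG) :
    |cov[F, G; ν]| ≤ 16 * N * (n : ℝ) ^ 2 * exp (2 * |t|) * exp ((1 - 7 / 8) / max 1 (R : ℝ) * (2 * w₀.length) / 2) *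
        exp (-((1 - 7 / 8) / max 1 (R : ℝ) / 2) * setDistEdges ΛF ΛG) *
      ((KF : ℝ) * KG + 2 * (|t| * Real.sqrt N * w₀.length) * (MF * KG + MG * KF) + 2 * MF * MG) := by
  have hA : (1 : ℝ) ≤ 16 * N := by
    have : (2 : ℝ) ≤ N := by exact_mod_cast hN
    linarith
  exact ballZdG_singleLoop_massGap_of_uniform (suN_uniformMassGapOnBallZdG_1_64 hN hβ R) hA hW w₀ t hν hF hMF hG hMG hn₁ hn₂ hdisj

end SUN


end Summit.Ventures.YMGap.RobustBall

end
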